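import Literature.NumberTheory.ComplexMultiplication.CMTypeRankPartitionSlots
import Literature.NumberTheory.ComplexMultiplication.CMTypeRankMultiplicityOne
import Literature.NumberTheory.ComplexMultiplication.PointwiseConjugationSlots
import HarnessLib

/-!
# MULTI-FIELD WEIL ENGINE, census tools — invariant dot product, minimal stable subspaces, a common constituent from two injective restrictions;
# restriction of `U(Σ)` to a sub-family and the regrouping transport; a nondegenerate pair of slots is jointly onto

Cell `pub-hodgecm2` (COR-CM), seat b30 gen 36 (2026-08-25); count-neutral own lane MULTI-FIELD WEIL ENGINE (stem `MultiFieldWeil*`).  Abstract setting of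
`Literature/NumberTheory/ComplexMultiplication/CMTypeRank*` (seats p2 ∕ b16): a group `G` acting on finite sets `E_i`, types `Φ_i ⊆ E_i`, the family type
`Σ = sigmaType Φ ⊆ ⊔_i E_i`, the antisymmetric spans `U(Φ) = antiSpan G Φ`, the rank `typeRank`.  Theorems only (the first five re-prove, publicly, private
tools of `CMTypeRankCommonConstituent` ∕ `CMTypeRankPartitionSlots`; the invariance of the dot product and the stability of orthogonal complements are seat b16's
`PointwiseConj.comp_smul_mem_orthogonal`, imported); no definition, no named fact, no `sorry`;
nothing Hodge-theoretic is asserted and `HC_CM` is NOT touched.  Consumer: `CorCM/MultiFieldWeilPairAdditiveBlocks.lean` (block additivity with additive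
exceptional pairs).

* `isRefl_dotProductBilin_rat`, `nondegenerate_dotProductBilin_rat` — the positive form on a permutation module `ℚ^X`; `exists_minimal_stable_submodule`, `forall_eq_zero_or_injOn_of_minimal_stable` — minimal stable subspaces and the
  zero-or-injective dichotomy; **`not_pairwise_of_two_injOn`** — two equivariant maps injective on one non-zero stable `P` exhibit a common constituent of their
  target modules (the negation of p2's «pairwise» predicate).
* `map_funLeft_subtype_antiSpan_sigmaType` (restriction of `U(Σ)` to the sub-family of the slots satisfying `p` is ONTO `U(Σ|_p)`),
  `map_funLeft_regroup_antiSpan_sigmaType` (`U(Σ)` read through `(c, (i, s)) ↦ (i, s)` is `U(⊔_c Σ|_c)`), **`jointlyOnto_of_typeRank_pair_eq`** (if the two-member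
  sub-family `{i, j}` has maximal rank then every `(a, b) ∈ U(Φ_i) × U(Φ_j)` is the pair of restrictions of one `m ∈ U(Σ)`).

[cite: Serre1977, §1.3, §2.2 Prop. 4] [cite: Gordon1999HodgeAVSurvey, §3 Theorem (proof), 7.5–7.6] [cite: Deligne1982HodgeCycles, I Ex. 3.7 (c)]

## References
* [Serre1977] J.-P. Serre, *Linear Representations of Finite Groups*, GTM 42, §1.3, §2.2.  [Gordon1999HodgeAVSurvey] B. B. Gordon, *A survey of the Hodge
  conjecture for abelian varieties*, §3 Theorem with proof; 7.5–7.7.  [Deligne1982HodgeCycles] P. Deligne, LNM 900 (1982), I Ex. 3.7.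

Provenance: Literature home (namespace `Literature.NumberTheory.ComplexMultiplication.MultiFieldWeil`) of the Summits-side `CorCM/MultiFieldWeilPairAdditiveTools` (cell `pub-hodgecm2`, COR-CM; all its imports are `Literature/`, Mathlib and the already re-homed `PointwiseConjugationSlots`), which `Literature/` may not import; theorems only, no named fact, no definition. Nothing here bears on `HC_CM`. Lane `lit-hodgefound` (Layer A3: CM types, their Kubota ranks and Galois combinatorics), seat p20.
-/

set_option autoImplicit false

noncomputable section

open scoped BigOperators

namespace Literature.NumberTheory.ComplexMultiplication.MultiFieldWeil

open Literature.NumberTheory.ComplexMultiplication.PointwiseConjugation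

open Literature.NumberTheory.ComplexMultiplication

universe u v w

variable {G : Type w} [Group G] {I : Type u} {E : I → Type v} [∀ i, MulAction G (E i)] {C : Type u}

/-! ## Tools -/

section Invariance

variable {X : Type*} [MulAction G X] [Fintype X]

omit [MulAction G X] in
/-- The dot product on `ℚ^X` is reflexive. [cite: Deligne1982HodgeCycles, I Ex. 3.7 (c)] -/
theorem isRefl_dotProductBilin_rat : (dotProductBilin ℚ ℚ : LinearMap.BilinForm ℚ (X → ℚ)).IsRefl := by
  intro x y h
  change x ⬝ᵥ y = 0 at h
  change y ⬝ᵥ x = 0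
  rwa [dotProduct_comm]

omit [MulAction G X] in
/-- The dot product on `ℚ^X` is non-degenerate (positive definite). [cite: Deligne1982HodgeCycles, I Ex. 3.7 (c)] -/
theorem nondegenerate_dotProductBilin_rat : (dotProductBilin ℚ ℚ : LinearMap.BilinForm ℚ (X → ℚ)).Nondegenerate := by
  rw [LinearMap.IsRefl.nondegenerate_iff_separatingLeft isRefl_dotProductBilin_rat]
  intro x hx
  have := hx x
  change x ⬝ᵥ x = 0 at this
  exact dotProduct_self_eq_zero.1 this

/-- A non-zero `G`-stable subspace of `ℚ^X` contains a MINIMAL non-zero `G`-stable subspace. [cite: Serre1977, §1.3] -/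
theorem exists_minimal_stable_submodule {C₀ : Submodule ℚ (X → ℚ)} (hC : C₀ ≠ ⊥) (hCst : ∀ g : G, ∀ f ∈ C₀, (fun x => f (g • x)) ∈ C₀) :
    ∃ P : Submodule ℚ (X → ℚ), P ≤ C₀ ∧ P ≠ ⊥ ∧ (∀ g : G, ∀ f ∈ P, (fun x => f (g • x)) ∈ P) ∧
      ∀ P' : Submodule ℚ (X → ℚ), P' ≤ P → P' ≠ ⊥ → (∀ g : G, ∀ f ∈ P', (fun x => f (g • x)) ∈ P') → P' = P := by
  classical
  have hex : ∃ n, ∃ P : Submodule ℚ (X → ℚ), P ≤ C₀ ∧ P ≠ ⊥ ∧ (∀ g : G, ∀ f ∈ P, (fun x => f (g • x)) ∈ P) ∧ Module.finrank ℚ P = n :=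
    ⟨_, C₀, le_rfl, hC, hCst, rfl⟩
  obtain ⟨P, hPC, hP0, hPst, hPn⟩ := Nat.find_spec hex
  refine ⟨P, hPC, hP0, hPst, fun P' hP'P hP'0 hP'st => ?_⟩
  have hmin := Nat.find_min' hex ⟨P', hP'P.trans hPC, hP'0, hP'st, rfl⟩
  exact Submodule.eq_of_le_of_finrank_eq hP'P (le_antisymm (Submodule.finrank_mono hP'P) (hPn ▸ hmin))

omit [Fintype X] in
/-- In a minimal non-zero stable subspace `P`, an equivariant linear map is ZERO OR INJECTIVE on `P`. [cite: Serre1977, §2.2 Prop. 4 (proof)] -/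
theorem forall_eq_zero_or_injOn_of_minimal_stable {Y : Type*} [MulAction G Y] {P : Submodule ℚ (X → ℚ)}
    (hPst : ∀ g : G, ∀ f ∈ P, (fun x => f (g • x)) ∈ P)
    (hPmin : ∀ P' : Submodule ℚ (X → ℚ), P' ≤ P → P' ≠ ⊥ → (∀ g : G, ∀ f ∈ P', (fun x => f (g • x)) ∈ P') → P' = P)
    (S : (X → ℚ) →ₗ[ℚ] (Y → ℚ)) (hS : ∀ g : G, ∀ f ∈ P, S (fun x => f (g • x)) = fun y => S f (g • y)) :
    (∀ f ∈ P, S f = 0) ∨ ∀ f ∈ P, S f = 0 → f = 0 := by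
  by_cases hK : P ⊓ LinearMap.ker S = ⊥
  · refine Or.inr fun f hf hf0 => ?_
    have : f ∈ P ⊓ LinearMap.ker S := ⟨hf, LinearMap.mem_ker.2 hf0⟩
    rw [hK] at this
    exact (Submodule.mem_bot ℚ).1 this
  · refine Or.inl fun f hf => ?_
    have hKst : ∀ g : G, ∀ f ∈ P ⊓ LinearMap.ker S, (fun x => f (g • x)) ∈ P ⊓ LinearMap.ker S :=
      fun g f hf => Submodule.mem_inf.2 ⟨hPst g f (Submodule.mem_inf.1 hf).1, by
        have h0 : S f = 0 := LinearMap.mem_ker.1 (Submodule.mem_inf.1 hf).2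
        rw [LinearMap.mem_ker, hS g f (Submodule.mem_inf.1 hf).1, h0]
        rfl⟩
    have hKP := hPmin _ inf_le_left hK hKst
    have : f ∈ P ⊓ LinearMap.ker S := by rw [hKP]; exact hf
    exact LinearMap.mem_ker.1 this.2

omit [Fintype X] in
/-- **A common constituent from two injective restrictions.**  `P` a `G`-stable subspace of `ℚ^X` on which the equivariant linear maps `S : ℚ^X → ℚ^Y`,
`S' : ℚ^X → ℚ^{Y'}` are injective resp. injective, `S(P) ≤ V`, `S'(P) ≤ V'`, `P ≠ 0`: then `V`, `V'` have a common constituent — some non-zero stable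
`Q ≤ V` (namely `S(P)`) carries a linear `T : ℚ^Y → ℚ^{Y'}` equivariant and injective on `Q` with `T(Q) ≤ V'`. [cite: Serre1977, §2.2 Prop. 4 (proof)] -/
theorem not_pairwise_of_two_injOn {Y Y' : Type*} [MulAction G Y] [MulAction G Y'] {P : Submodule ℚ (X → ℚ)} (hP0 : P ≠ ⊥)
    (hPst : ∀ g : G, ∀ f ∈ P, (fun x => f (g • x)) ∈ P) (S : (X → ℚ) →ₗ[ℚ] (Y → ℚ)) (S' : (X → ℚ) →ₗ[ℚ] (Y' → ℚ))
    (hS : ∀ g : G, ∀ f ∈ P, S (fun x => f (g • x)) = fun y => S f (g • y)) (hS' : ∀ g : G, ∀ f ∈ P, S' (fun x => f (g • x)) = fun y => S' f (g • y))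
    (hinj : ∀ f ∈ P, S f = 0 → f = 0) (hinj' : ∀ f ∈ P, S' f = 0 → f = 0) {V : Submodule ℚ (Y → ℚ)} {V' : Submodule ℚ (Y' → ℚ)}
    (hSV : ∀ f ∈ P, S f ∈ V) (hS'V' : ∀ f ∈ P, S' f ∈ V') :
    ¬ ∀ Q : Submodule ℚ (Y → ℚ), Q ≤ V → (∀ g : G, ∀ f ∈ Q, (fun x => f (g • x)) ∈ Q) →
      ∀ T : (Y → ℚ) →ₗ[ℚ] (Y' → ℚ), (∀ g : G, ∀ f ∈ Q, T (fun x => f (g • x)) = fun y => T f (g • y)) →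
        (∀ f ∈ Q, T f ∈ V') → (∀ f ∈ Q, T f = 0 → f = 0) → Q = ⊥ := by
  intro hpair
  have hinjr : Function.Injective (S.domRestrict P) := by
    intro f f' hff'
    apply Subtype.ext
    have h0 : S ((f : X → ℚ) - f') = 0 := by rw [map_sub, sub_eq_zero]; exact hff'
    exact sub_eq_zero.1 (hinj _ (P.sub_mem f.2 f'.2) h0)
  obtain ⟨T, hT⟩ := LinearMap.exists_extend ((S'.domRestrict P) ∘ₗ (LinearEquiv.ofInjective (S.domRestrict P) hinjr).symm.toLinearMap)
  have hTc : ∀ f : P, T (S f) = S' f := fun f => by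
    have h1 := LinearMap.congr_fun hT (LinearEquiv.ofInjective (S.domRestrict P) hinjr f)
    simpa only [LinearMap.comp_apply, Submodule.coe_subtype, LinearEquiv.coe_toLinearMap, LinearEquiv.symm_apply_apply, LinearMap.domRestrict_apply,
      LinearEquiv.ofInjective_apply] using h1
  have hmem : ∀ a, a ∈ LinearMap.range (S.domRestrict P) ↔ ∃ f ∈ P, S f = a := fun a => by
    rw [LinearMap.mem_range]
    constructor
    · rintro ⟨f, rfl⟩; exact ⟨f, f.2, rfl⟩
    · rintro ⟨f, hf, rfl⟩; exact ⟨⟨f, hf⟩, rfl⟩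
  have hQ0 : LinearMap.range (S.domRestrict P) = ⊥ := by
    refine hpair _ ?_ ?_ T ?_ ?_ ?_
    · intro a ha
      obtain ⟨f, hf, rfl⟩ := (hmem a).1 ha
      exact hSV f hf
    · intro g a ha
      obtain ⟨f, hf, rfl⟩ := (hmem a).1 ha
      exact (hmem _).2 ⟨fun x => f (g • x), hPst g f hf, hS g f hf⟩
    · intro g a ha
      obtain ⟨f, hf, rfl⟩ := (hmem a).1 ha
      have h1 := hTc ⟨f, hf⟩
      have h2 := hTc ⟨fun x => f (g • x), hPst g f hf⟩
      simp only at h1 h2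
      rw [hS g f hf] at h2
      rw [h2, h1, hS' g f hf]
    · intro a ha
      obtain ⟨f, hf, rfl⟩ := (hmem a).1 ha
      have h1 := hTc ⟨f, hf⟩
      simp only at h1
      rw [h1]
      exact hS'V' f hf
    · intro a ha ha0
      obtain ⟨f, hf, rfl⟩ := (hmem a).1 ha
      have h1 := hTc ⟨f, hf⟩
      simp only at h1
      rw [h1] at ha0
      rw [hinj' f hf ha0, map_zero]
  obtain ⟨f₀, hf₀, hf₀0⟩ := (Submodule.ne_bot_iff P).1 hP0
  have hmemf : S f₀ ∈ LinearMap.range (S.domRestrict P) := (hmem _).2 ⟨f₀, hf₀, rfl⟩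
  rw [hQ0, Submodule.mem_bot] at hmemf
  exact hf₀0 (hinj f₀ hf₀ hmemf)

end Invariance

section Restrict

/-- **Restriction of `U(Σ)` to a sub-family is ONTO `U(Σ|_S)`** (`S` = the slots satisfying `p`; the `±1`-vectors restrict to `±1`-vectors).
[cite: Gordon1999HodgeAVSurvey, §3 Theorem (proof)] -/
theorem map_funLeft_subtype_antiSpan_sigmaType (Φ : ∀ i, Set (E i)) (p : I → Prop) :
    (antiSpan G (sigmaType Φ)).map (LinearMap.funLeft ℚ ℚ fun x : (Σ j : {j // p j}, E j.1) => (⟨x.1.1, x.2⟩ : Σ i, E i)) =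
      antiSpan G (sigmaType fun j : {j // p j} => Φ j.1) := by
  have hv : ∀ g : G, LinearMap.funLeft ℚ ℚ (fun x : (Σ j : {j // p j}, E j.1) => (⟨x.1.1, x.2⟩ : Σ i, E i)) (antiVec (sigmaType Φ) g) =
      antiVec (sigmaType fun j : {j // p j} => Φ j.1) g := fun g => by
    funext x
    rw [LinearMap.funLeft_apply, antiVec_sigmaType, antiVec_sigmaType]
  simp only [antiSpan, Submodule.map_span, ← Set.range_comp, Function.comp_def, hv]

/-- **Regrouping transport**: reading a weight of `⊔_i E_i` through the regrouping map `(c, (i, s)) ↦ (i, s)` carries `U(Σ)` onto `U(⊔_c Σ|_c)`.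
[cite: Deligne1982HodgeCycles, I Ex. 3.7 (c)] -/
theorem map_funLeft_regroup_antiSpan_sigmaType (Φ : ∀ i, Set (E i)) (κ : I → C) :
    (antiSpan G (sigmaType Φ)).map (LinearMap.funLeft ℚ ℚ fun x : (Σ c, Σ i : {i // κ i = c}, E i.1) => (⟨x.2.1.1, x.2.2⟩ : Σ i, E i)) =
      antiSpan G (sigmaType fun c => sigmaType fun i : {i // κ i = c} => Φ i.1) := by
  have hv : ∀ g : G, LinearMap.funLeft ℚ ℚ (fun x : (Σ c, Σ i : {i // κ i = c}, E i.1) => (⟨x.2.1.1, x.2.2⟩ : Σ i, E i)) (antiVec (sigmaType Φ) g) =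
      antiVec (sigmaType fun c => sigmaType fun i : {i // κ i = c} => Φ i.1) g := fun g => by
    funext x
    rw [LinearMap.funLeft_apply, antiVec_sigmaType, antiVec_sigmaType, antiVec_sigmaType]
  simp only [antiSpan, Submodule.map_span, ← Set.range_comp, Function.comp_def, hv]

variable [Fintype I] [DecidableEq I] [∀ i, Fintype (E i)]

/-- **A NONDEGENERATE PAIR IS JOINTLY ONTO.**  If the two-member sub-family `{i, j}` (`i ≠ j`) has maximal rank `rank(Σ|_{{i,j}}) = |E_i ⊔ E_j|/2 + 1`, then for
all `a ∈ U(Φ_i)`, `b ∈ U(Φ_j)` some `m ∈ U(Σ)` restricts to `a` on the slot `i` and to `b` on the slot `j` (a nondegenerate family is additive,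
`forall_map_slotExt_le_of_typeRank_sigmaType_eq`; restriction to the sub-family is onto). [cite: Gordon1999HodgeAVSurvey, 7.5–7.6] -/
theorem jointlyOnto_of_typeRank_pair_eq [∀ i, Nonempty (E i)] {ρ : G} {Φ : ∀ i, Set (E i)} (h : ∀ i, IsCMTypeWith ρ (Φ i)) {i j : I} (hij : i ≠ j)
    (hnd : typeRank G (sigmaType fun l : {l // l = i ∨ l = j} => Φ l.1) = Fintype.card (Σ l : {l // l = i ∨ l = j}, E l.1) / 2 + 1)
    (a : E i → ℚ) (ha : a ∈ antiSpan G (Φ i)) (b : E j → ℚ) (hb : b ∈ antiSpan G (Φ j)) :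
    ∃ m ∈ antiSpan G (sigmaType Φ), LinearMap.funLeft ℚ ℚ (Sigma.mk i) m = a ∧ LinearMap.funLeft ℚ ℚ (Sigma.mk j) m = b := by
  classical
  set p : I → Prop := fun l => l = i ∨ l = j with hp_def
  let i' : {l // p l} := ⟨i, Or.inl rfl⟩
  let j' : {l // p l} := ⟨j, Or.inr rfl⟩
  haveI : Nonempty {l // p l} := ⟨i'⟩
  have hadd := forall_map_slotExt_le_of_typeRank_sigmaType_eq (G := G) (Φ := fun l : {l // p l} => Φ l.1) (fun l => h l.1) hnd
  -- the assembled weight of the pair lies in `U(Σ|_{{i,j}})`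
  have hw : slotExt i' a + slotExt j' b ∈ antiSpan G (sigmaType fun l : {l // p l} => Φ l.1) :=
    Submodule.add_mem _ (hadd i' ⟨a, ha, rfl⟩) (hadd j' ⟨b, hb, rfl⟩)
  -- lift along the restriction
  rw [← map_funLeft_subtype_antiSpan_sigmaType Φ p] at hw
  obtain ⟨m, hm, hmw⟩ := hw
  have hij' : j' ≠ i' := fun h' => hij (congrArg Subtype.val h').symm
  refine ⟨m, hm, ?_, ?_⟩
  · funext s
    have e := congrFun hmw ⟨i', s⟩
    rw [LinearMap.funLeft_apply] at e
    rw [LinearMap.funLeft_apply, e, Pi.add_apply, slotExt_apply_same, slotExt_apply_of_ne hij'.symm, add_zero]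
  · funext s
    have e := congrFun hmw ⟨j', s⟩
    rw [LinearMap.funLeft_apply] at e
    rw [LinearMap.funLeft_apply, e, Pi.add_apply, slotExt_apply_same, slotExt_apply_of_ne hij', zero_add]

end Restrict

end Literature.NumberTheory.ComplexMultiplication.MultiFieldWeil

end
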